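import Summits.QuantumFields.YangMills.Theorems.BalabanUVNodesN07QOfRecordOntoSmallField
import Summits.QuantumFields.YangMills.Theorems.BalabanUVNodesN07QprOfRecordOntoGuarded
import HarnessLib

/-!
# BalabanUVNodes ∕ N07 — THE UN-FRAMED ONTO ROW «`qCplxOp k U₀` onto» AT EVERY GUARDED SMALL-FIELD BACKGROUND, AND THE GL PIN'S FRAMED `hQ` DISCHARGED THERE

Cell `pub-ymgap`, DAG node N07 ([Balaban1985Variational] Thm 1 ∕ Props 2–9), seat `pub-ymgap-dag-n07-e` (g39); `--kind proof --supports stmt-QuantumFields-27238 --as helper`;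
count-neutral.  [B9] = [Balaban1985BackgroundPropagators]; [15] = [Balaban1985Variational]; [B7] = [Balaban1985Averaging].

WHY.  The K0ᴬ triage of record (porter PT-B g11, director-ym №645∕№647, 2026-08-31) lists as wall {W1} (un-framed half) the displayed row «`Function.Surjective (qCplxOp k U₀)`
at a guarded background `U₀ ≠ 1`» — [B7] Sect. E's submersion property of `U ↦ Ū^k(U)` — to which PT-B's ✓`N07QprOfRecordOntoGuarded.QprOfRecord_surjective_hierFrameGL_of_qCplxOp`
reduces the framed admissibility binder `hQ : Function.Surjective (QprOfRecord F N k U₀ (hierFrameGLDatumOfRecord F N k U₀))` of the closed GL pin.  That row is ALREADY the content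
of this lineage's ✓`N07QOfRecordOntoSmallField.exists_skew_qSkewOp_eq` (g38, MODULE 144: every skew level-`k` field is `qSkewOp k U₀` of a skew fine field at every guarded
small-field `U₀`, parts (A) exact corrector on `𝔰𝔲(N)` + (B) phase equivariance on the U(1) line) read through dag-n07-w3's real-form criterion
✓`N07QOfRecordFlatOnto.cplxOp_surjective_of_skew` (`qCplxOp k U₀ = cplxOp (qSkewOp k U₀)` by `rfl`).  This file writes the composition down BY NAME, in the guard currencies the
consumers hold (per-level plaquette smallness `t₀`; the (2)-class `bgReg … ε₀` below four explicit ceilings; `IsBackground`; the selector `UkSel` and its centred rooted gauge).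

WHAT IS PROVED (sorry-free; no definition; standard axioms).
* §1 (generic torus `P`) ★★★ `qCplxOp_surjective_of_plaqSmall` — `k ≤ m + K`, `Ū^i(U₀)` `t₀`-plaquette-small for `i < k`, `stokesConst·t₀ < |I|⁻¹∕16` and `< δ_N` ⟹
  `Function.Surjective (qCplxOp k U₀)`.
* §2 (the record `F.P K`, `avOfRecord F N K`) `qCplxOp_surjective_of_plaqSmall_rec` · `smallBelow_avOfRecord_of_plaqSmall` · ★★★ `qCplxOp_surjective_of_mem_bgReg` ·
  `smallBelow_avOfRecord_of_mem_bgReg` · `qCplxOp_surjective_of_isBackground` · `qCplxOp_surjective_ukSel` · `qCplxOp_surjective_gaugeAct` · `exists_eps_qCplxOp_surjective_of_mem_bgReg`.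
* §3 (the GL pin) ★★★★ `QprOfRecord_surjective_hierFrameGL_of_plaqSmall` — at every guarded small-field background the framed `hQ` of def-Y's completed hierarchical frame of record
  HOLDS: `Function.Surjective (QprOfRecord F N k U₀ (hierFrameGLDatumOfRecord F N k U₀))`; class readings `…_of_mem_bgReg` · `…_of_isBackground` · `…_ukSel` · `…_gaugeAct` ·
  `…_rootGaugeC_ukSel` (DEF-1's `recordBgFieldC` shape) · `exists_eps_QprOfRecord_surjective_hierFrameGL_of_mem_bgReg` (one `ε₀ > 0` per `(d, L, N)`).

HONEST SCOPE.  Composition by name of landed theorems; the analytic input is the corrector road of MODULE 142∕143 (thresholds `|I|⁻¹∕16`, `δ_N = min(1∕3, π∕N)` — the corrector's,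
NOT print's `O(L²α₀)`); nothing of [B7] Sect. E ∕ [B9] Thm 3.11 ∕ Thm 3.12 is asserted; the SL datum `hierFrameDatumOfRecord` is NOT covered (no all-matrix (3.114) token — def-Y
TRACE FLAG); `hpos` ({W1} framed half), {W2}, {W3}, {W4} untouched; K0ᴬ ⟨27238⟩ NOT closed; N07 NOT discharged; COUNT∕K unmoved; one finite 𝕋⁴ programme at fixed `ε` — nothing
continuum ∕ ℝ⁴ ∕ OS ∕ mass gap ∕ Clay.  **The Yang–Mills mass gap is NOT proved by any of this.**  No `sorry`, no `def`, no `instance`, no `notation`.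
-/

noncomputable section

open scoped Matrix.Norms.L2Operator BigOperators

namespace Summit.QuantumFields.YangMills.Theorems.N07QCplxOpOntoGuarded

open Literature.MathematicalPhysics.QuantumFieldTheory.Balaban1983to89
open Literature.MathematicalPhysics.QuantumFieldTheory.Balaban1983to89.T4Continuum
open Literature.MathematicalPhysics.QuantumFieldTheory.Balaban1983to89.BlockAveraging
open Literature.MathematicalPhysics.QuantumFieldTheory.Balaban1983to89.BlockAveragingEMLHaarAC (emlWeight)
open Literature.MathematicalPhysics.QuantumFieldTheory.Balaban1983to89.ExpMeanLog (expMeanLogSU deltaSU)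
open Literature.MathematicalPhysics.QuantumFieldTheory.Balaban1983to89.Node00
open Summit.QuantumFields.YangMills.Theorems.BlockAvgCorrector (stokesConst)
open Summit.QuantumFields.YangMills.BalabanUVNodes.N07CritTangentConverse (smallBelow_of_plaqSmall)
open Summit.QuantumFields.YangMills.BalabanUVNodes.N07CritTangentInClass (plaqSmall_avgFamily_of_mem_bgReg exists_admissible_eps)
open Summit.QuantumFields.YangMills.BalabanUVNodes.N07QOfRecordOntoSmallField (exists_skew_qSkewOp_eq ukSel_mem_bgReg)
open Summit.QuantumFields.YangMills.Theorems.N07QOfRecordFlatOnto (cplxOp_surjective_of_skew)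
open Summit.QuantumFields.YangMills.Theorems.N07QprOfRecordOntoGuarded (QprOfRecord_surjective_hierFrameGL_of_qCplxOp)
open GaugeField (gaugeAct)

/-! ## §1  Generic torus: print's `Q_k(U₀)` on `𝔤ᶜ`-valued fields is onto at every guarded small-field background -/

section Lattice

variable {P : Params} {N : ℕ} [NeZero N]

/-- ★★★ **THE UN-FRAMED ONTO ROW AT A GUARDED SMALL-FIELD BACKGROUND**: on a torus `P`, for `k ≤ m + K` and a background `U₀` whose iterated (0.4) averages `Ū^i(U₀)`,
`i < k`, are `t₀`-plaquette-small with `stokesConst P·t₀ < emlWeight P∕16` and `< deltaSU (Fin N)`, def-Y's complexified linearised averaging is onto: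
`Function.Surjective (qCplxOp k U₀)`.  Proof: `qCplxOp k U₀ = cplxOp (qSkewOp k U₀)`; dag-n07-w3's real-form criterion `cplxOp_surjective_of_skew` asks for skew preimages of
skew targets, which is MODULE 144's `exists_skew_qSkewOp_eq`. [cite: Balaban1985BackgroundPropagators, (3.13)–(3.16) p.393; Balaban1985Variational, (44)–(45) p.285; Balaban1985Averaging, Prop. 3 (124)–(125) p.36; Balaban1987RG1, (0.4) p.253] -/
theorem qCplxOp_surjective_of_plaqSmall {t₀ : ℝ} (ht₀ : 0 < t₀) (hst : stokesConst P * t₀ < emlWeight P / 16)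
    (hstδ : stokesConst P * t₀ < deltaSU (Fin N)) {k : ℕ} (hk : k ≤ P.m + P.K) {U₀ : GaugeField P 0 (SU N)}
    (hsm : ∀ i, i < k → PlaqSmall t₀ (Averaging.iter (fun i => blockAvg (P := P) (j := i) (expMeanLogSU (n := Fin N))) i U₀)) :
    Function.Surjective (qCplxOp k U₀) := by
  show Function.Surjective (cplxOp (qSkewOp k U₀))
  refine cplxOp_surjective_of_skew (qSkewOp k U₀) fun Z hZ => ?_
  obtain ⟨Y, hY, h⟩ := exists_skew_qSkewOp_eq ht₀ hst hstδ hk hsm Z (fun c => by rw [Matrix.star_eq_conjTranspose]; exact hZ c)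
  exact ⟨Y, fun b => by rw [← Matrix.star_eq_conjTranspose]; exact hY b, h⟩

end Lattice

/-! ## §2  At the record: the guard currencies the consumers hold -/

section Record

variable {F : T4Family} {N : ℕ} [NeZero N]

/-- ★★ **THE UN-FRAMED ONTO ROW ON THE RECORD'S TORUS** `F.P K` with the averaging of record `avOfRecord F N K` (per-level plaquette smallness `t₀` of `Ū^i(U₀)`, `i < k`,
below the corrector's two thresholds; `k ≤ m + K`): `Function.Surjective (qCplxOp k U₀)`. [cite: Balaban1985BackgroundPropagators, (3.13)–(3.16) p.393; Balaban1985Variational, (44)–(45) p.285] -/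
theorem qCplxOp_surjective_of_plaqSmall_rec {K k : ℕ} (hk : k ≤ (F.P K).m + (F.P K).K) {t₀ : ℝ} (ht₀ : 0 < t₀)
    (hst : stokesConst (F.P K) * t₀ < emlWeight (F.P K) / 16) (hstδ : stokesConst (F.P K) * t₀ < deltaSU (Fin N)) {U₀ : GaugeField (F.P K) 0 (SU N)}
    (hsm : ∀ i, i < k → PlaqSmall t₀ (Averaging.iter (avOfRecord F N K) i U₀)) :
    Function.Surjective (qCplxOp k U₀) :=
  qCplxOp_surjective_of_plaqSmall ht₀ hst hstδ hk hsm

/-- ★ **THE RECORD'S GUARD `SmallBelow` FROM PER-LEVEL PLAQUETTE SMALLNESS** (`stokesConst·t₀ < δ_N`; dag-n07-w5's `smallBelow_of_plaqSmall` at `avOfRecord`).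
[cite: Balaban1987RG1, (0.4) p.253, (0.21) p.256] -/
theorem smallBelow_avOfRecord_of_plaqSmall {K k : ℕ} {t₀ : ℝ} (ht₀ : 0 < t₀) (hstδ : stokesConst (F.P K) * t₀ < deltaSU (Fin N))
    {U₀ : GaugeField (F.P K) 0 (SU N)} (hsm : ∀ i, i < k → PlaqSmall t₀ (Averaging.iter (avOfRecord F N K) i U₀)) :
    SmallBelow (avOfRecord F N K) k U₀ :=
  smallBelow_of_plaqSmall ht₀ hstδ hsm

/-- ★★★ **THE UN-FRAMED ONTO ROW FOR EVERY MEMBER OF [15] (2)'s CLASS**: `U₀ ∈ bgReg F N K k ε₀` with `ε₀ > 0` below the four ceilings `143·((d+4)²∕4)²·ε₀ ≤ 1∕3`,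
`2ε₀ ≤ 2δ_N∕((d+4)L)²`, `stokesConst·2ε₀ < |I|⁻¹∕16`, `stokesConst·2ε₀ < δ_N`, and `k ≤ m + K` ⟹ `Function.Surjective (qCplxOp k U₀)` (the per-level smallness `2ε₀` is MODULE 35d's
`plaqSmall_avgFamily_of_mem_bgReg`). [cite: Balaban1985Variational, (2) p.278, (44)–(45) p.285; Balaban1985Averaging, Prop. 2 (52)–(54) p.26] -/
theorem qCplxOp_surjective_of_mem_bgReg {K k : ℕ} (hk : k ≤ (F.P K).m + (F.P K).K) {ε₀ : ℝ} (hε₀ : 0 < ε₀)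
    (h3 : (143 * (((((F.P K).d + 4 : ℕ) : ℝ)) ^ 2 / 4) ^ 2) * ε₀ ≤ 1 / 3)
    (h2 : 2 * ε₀ ≤ 2 * deltaSU (Fin N) / ((((F.P K).d + 4) * (F.P K).L : ℕ) : ℝ) ^ 2)
    (hst : stokesConst (F.P K) * (2 * ε₀) < emlWeight (F.P K) / 16) (hstδ : stokesConst (F.P K) * (2 * ε₀) < deltaSU (Fin N))
    {U₀ : GaugeField (F.P K) 0 (SU N)} (hU : U₀ ∈ bgReg F N K k ε₀) :
    Function.Surjective (qCplxOp k U₀) :=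
  qCplxOp_surjective_of_plaqSmall_rec hk (by positivity : (0 : ℝ) < 2 * ε₀) hst hstδ
    fun i hi => plaqSmall_avgFamily_of_mem_bgReg hε₀ h3 h2 hU hi.le

/-- ★ **THE RECORD'S GUARD ON THE (2)-CLASS**: `U₀ ∈ bgReg F N K k ε₀` (three of the four ceilings) ⟹ `SmallBelow (avOfRecord F N K) k U₀`.
[cite: Balaban1987RG1, (0.4) p.253; Balaban1985Variational, (2) p.278; Balaban1985Averaging, Prop. 2 (52)–(54) p.26] -/
theorem smallBelow_avOfRecord_of_mem_bgReg {K k : ℕ} {ε₀ : ℝ} (hε₀ : 0 < ε₀)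
    (h3 : (143 * (((((F.P K).d + 4 : ℕ) : ℝ)) ^ 2 / 4) ^ 2) * ε₀ ≤ 1 / 3)
    (h2 : 2 * ε₀ ≤ 2 * deltaSU (Fin N) / ((((F.P K).d + 4) * (F.P K).L : ℕ) : ℝ) ^ 2)
    (hstδ : stokesConst (F.P K) * (2 * ε₀) < deltaSU (Fin N))
    {U₀ : GaugeField (F.P K) 0 (SU N)} (hU : U₀ ∈ bgReg F N K k ε₀) :
    SmallBelow (avOfRecord F N K) k U₀ :=
  smallBelow_avOfRecord_of_plaqSmall (by positivity : (0 : ℝ) < 2 * ε₀) hstδ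
    fun i hi => plaqSmall_avgFamily_of_mem_bgReg hε₀ h3 h2 hU hi.le

/-- ★★ **… AT EVERY MINIMISER OF RECORD OVER THE CLASS** (`IsBackground (avOfRecord F N K) (bgReg F N K k ε₀) k V U₀`). [cite: Balaban1985Variational, Thm 1 p.279, (44)–(45) p.285] -/
theorem qCplxOp_surjective_of_isBackground {K k : ℕ} (hk : k ≤ (F.P K).m + (F.P K).K) {ε₀ : ℝ} (hε₀ : 0 < ε₀)
    (h3 : (143 * (((((F.P K).d + 4 : ℕ) : ℝ)) ^ 2 / 4) ^ 2) * ε₀ ≤ 1 / 3)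
    (h2 : 2 * ε₀ ≤ 2 * deltaSU (Fin N) / ((((F.P K).d + 4) * (F.P K).L : ℕ) : ℝ) ^ 2)
    (hst : stokesConst (F.P K) * (2 * ε₀) < emlWeight (F.P K) / 16) (hstδ : stokesConst (F.P K) * (2 * ε₀) < deltaSU (Fin N))
    {V : GaugeField (F.P K) k (SU N)} {U₀ : GaugeField (F.P K) 0 (SU N)} (hbg : IsBackground (avOfRecord F N K) (bgReg F N K k ε₀) k V U₀) :
    Function.Surjective (qCplxOp k U₀) :=
  qCplxOp_surjective_of_mem_bgReg hk hε₀ h3 h2 hst hstδ hbg.2.1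

/-- ★★ **… AT THE SELECTOR OF RECORD `UkSel F N K k ε₀ V`, EVERY DATUM `V`** (on the solvable set a minimiser over the class, off it the flat field).
[cite: Balaban1985Variational, Thm 1 p.279, (44)–(45) p.285; Balaban1987RG1, (0.21) p.256] -/
theorem qCplxOp_surjective_ukSel {K k : ℕ} (hk : k ≤ (F.P K).m + (F.P K).K) {ε₀ : ℝ} (hε₀ : 0 < ε₀)
    (h3 : (143 * (((((F.P K).d + 4 : ℕ) : ℝ)) ^ 2 / 4) ^ 2) * ε₀ ≤ 1 / 3)
    (h2 : 2 * ε₀ ≤ 2 * deltaSU (Fin N) / ((((F.P K).d + 4) * (F.P K).L : ℕ) : ℝ) ^ 2)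
    (hst : stokesConst (F.P K) * (2 * ε₀) < emlWeight (F.P K) / 16) (hstδ : stokesConst (F.P K) * (2 * ε₀) < deltaSU (Fin N))
    (V : GaugeField (F.P K) k (SU N)) :
    Function.Surjective (qCplxOp k (UkSel F N K k ε₀ V)) :=
  qCplxOp_surjective_of_mem_bgReg hk hε₀ h3 h2 hst hstδ (ukSel_mem_bgReg hk hε₀ V)

/-- ★★ **… ALONG THE GAUGE ORBIT OF A CLASS MEMBER** (the class is gauge-invariant: `gaugeAct_mem_bgReg'`). [cite: Balaban1985Variational, (2) p.278, (7)–(9) p.279, (44)–(45) p.285] -/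
theorem qCplxOp_surjective_gaugeAct {K k : ℕ} (hk : k ≤ (F.P K).m + (F.P K).K) {ε₀ : ℝ} (hε₀ : 0 < ε₀)
    (h3 : (143 * (((((F.P K).d + 4 : ℕ) : ℝ)) ^ 2 / 4) ^ 2) * ε₀ ≤ 1 / 3)
    (h2 : 2 * ε₀ ≤ 2 * deltaSU (Fin N) / ((((F.P K).d + 4) * (F.P K).L : ℕ) : ℝ) ^ 2)
    (hst : stokesConst (F.P K) * (2 * ε₀) < emlWeight (F.P K) / 16) (hstδ : stokesConst (F.P K) * (2 * ε₀) < deltaSU (Fin N))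
    {U₀ : GaugeField (F.P K) 0 (SU N)} (hU : U₀ ∈ bgReg F N K k ε₀) (u : GaugeTransf (F.P K) 0 (SU N)) :
    Function.Surjective (qCplxOp k (gaugeAct u U₀)) :=
  qCplxOp_surjective_of_mem_bgReg hk hε₀ h3 h2 hst hstδ (gaugeAct_mem_bgReg' u U₀ hU)

/-- ★★ **ONE ADMISSIBLE `ε₀ > 0` PER `(d, L, N)`** below the four ceilings (MODULE 35d `exists_admissible_eps`): for it, `qCplxOp k U₀` is onto at every `U₀ ∈ bgReg F N K k ε₀`,
every `k ≤ m + K`. [cite: Balaban1985Variational, (2) p.278, (44)–(45) p.285] -/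
theorem exists_eps_qCplxOp_surjective_of_mem_bgReg (F : T4Family) (N : ℕ) [NeZero N] (K : ℕ) :
    ∃ ε₀ : ℝ, 0 < ε₀ ∧ ∀ k : ℕ, k ≤ (F.P K).m + (F.P K).K → ∀ U₀ : GaugeField (F.P K) 0 (SU N), U₀ ∈ bgReg F N K k ε₀ →
      Function.Surjective (qCplxOp k U₀) := by
  obtain ⟨ε₀, hε₀, h3, h2, hst, hstδ⟩ := exists_admissible_eps (F.P K) N
  exact ⟨ε₀, hε₀, fun k hk U₀ hU => qCplxOp_surjective_of_mem_bgReg hk hε₀ h3 h2 hst hstδ hU⟩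

/-! ## §3  The GL pin's framed `hQ` DISCHARGED at every guarded small-field background -/

/-- ★★★★ **THE FRAMED ADMISSIBILITY BINDER `hQ` OF THE CLOSED GL PIN HOLDS AT EVERY GUARDED SMALL-FIELD BACKGROUND**: on the record's torus, for `k ≤ m + K` and a background
`U₀` whose averages `Ū^i(U₀)`, `i < k`, are `t₀`-plaquette-small with `stokesConst·t₀ < |I|⁻¹∕16` and `< δ_N`:
`Function.Surjective (QprOfRecord F N k U₀ (hierFrameGLDatumOfRecord F N k U₀))` — PT-B's by-name reduction `QprOfRecord_surjective_hierFrameGL_of_qCplxOp` fed with §2's un-framed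
row and the record's guard `smallBelow_avOfRecord_of_plaqSmall`.  The flat row ✓`QprOfRecord_one_surjective_rec` is the case `U₀ = 1`.
[cite: Balaban1985BackgroundPropagators, (3.13)–(3.19) p.393, (3.113)–(3.115) p.418; Balaban1985Variational, (44)–(45) p.285, (103) p.293; Balaban1985Averaging, (84)–(92) pp.30–31] -/
theorem QprOfRecord_surjective_hierFrameGL_of_plaqSmall {K k : ℕ} (hk : k ≤ (F.P K).m + (F.P K).K) {t₀ : ℝ} (ht₀ : 0 < t₀)
    (hst : stokesConst (F.P K) * t₀ < emlWeight (F.P K) / 16) (hstδ : stokesConst (F.P K) * t₀ < deltaSU (Fin N)) {U₀ : GaugeField (F.P K) 0 (SU N)}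
    (hsm : ∀ i, i < k → PlaqSmall t₀ (Averaging.iter (avOfRecord F N K) i U₀)) :
    Function.Surjective (QprOfRecord F N k U₀ (hierFrameGLDatumOfRecord F N k U₀)) :=
  QprOfRecord_surjective_hierFrameGL_of_qCplxOp F N K k U₀ hk (smallBelow_avOfRecord_of_plaqSmall ht₀ hstδ hsm)
    (qCplxOp_surjective_of_plaqSmall_rec hk ht₀ hst hstδ hsm)

/-- ★★★ **THE GL PIN'S `hQ` FOR EVERY MEMBER OF THE (2)-CLASS** `U₀ ∈ bgReg F N K k ε₀` (`ε₀ > 0` below the four ceilings, `k ≤ m + K`).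
[cite: Balaban1985Variational, (2) p.278, (44)–(45) p.285, (103) p.293; Balaban1985BackgroundPropagators, (3.113)–(3.115) p.418] -/
theorem QprOfRecord_surjective_hierFrameGL_of_mem_bgReg {K k : ℕ} (hk : k ≤ (F.P K).m + (F.P K).K) {ε₀ : ℝ} (hε₀ : 0 < ε₀)
    (h3 : (143 * (((((F.P K).d + 4 : ℕ) : ℝ)) ^ 2 / 4) ^ 2) * ε₀ ≤ 1 / 3)
    (h2 : 2 * ε₀ ≤ 2 * deltaSU (Fin N) / ((((F.P K).d + 4) * (F.P K).L : ℕ) : ℝ) ^ 2)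
    (hst : stokesConst (F.P K) * (2 * ε₀) < emlWeight (F.P K) / 16) (hstδ : stokesConst (F.P K) * (2 * ε₀) < deltaSU (Fin N))
    {U₀ : GaugeField (F.P K) 0 (SU N)} (hU : U₀ ∈ bgReg F N K k ε₀) :
    Function.Surjective (QprOfRecord F N k U₀ (hierFrameGLDatumOfRecord F N k U₀)) :=
  QprOfRecord_surjective_hierFrameGL_of_plaqSmall hk (by positivity : (0 : ℝ) < 2 * ε₀) hst hstδ
    fun i hi => plaqSmall_avgFamily_of_mem_bgReg hε₀ h3 h2 hU hi.le

/-- ★★★ **THE GL PIN'S `hQ` AT EVERY MINIMISER OF RECORD OVER THE CLASS** (`IsBackground (avOfRecord F N K) (bgReg F N K k ε₀) k V U₀`).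
[cite: Balaban1985Variational, Thm 1 p.279, (44)–(45) p.285, (103) p.293] -/
theorem QprOfRecord_surjective_hierFrameGL_of_isBackground {K k : ℕ} (hk : k ≤ (F.P K).m + (F.P K).K) {ε₀ : ℝ} (hε₀ : 0 < ε₀)
    (h3 : (143 * (((((F.P K).d + 4 : ℕ) : ℝ)) ^ 2 / 4) ^ 2) * ε₀ ≤ 1 / 3)
    (h2 : 2 * ε₀ ≤ 2 * deltaSU (Fin N) / ((((F.P K).d + 4) * (F.P K).L : ℕ) : ℝ) ^ 2)
    (hst : stokesConst (F.P K) * (2 * ε₀) < emlWeight (F.P K) / 16) (hstδ : stokesConst (F.P K) * (2 * ε₀) < deltaSU (Fin N))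
    {V : GaugeField (F.P K) k (SU N)} {U₀ : GaugeField (F.P K) 0 (SU N)} (hbg : IsBackground (avOfRecord F N K) (bgReg F N K k ε₀) k V U₀) :
    Function.Surjective (QprOfRecord F N k U₀ (hierFrameGLDatumOfRecord F N k U₀)) :=
  QprOfRecord_surjective_hierFrameGL_of_mem_bgReg hk hε₀ h3 h2 hst hstδ hbg.2.1

/-- ★★★ **THE GL PIN'S `hQ` AT THE SELECTOR OF RECORD `UkSel F N K k ε₀ V`, EVERY DATUM `V`**.
[cite: Balaban1985Variational, Thm 1 p.279, (44)–(45) p.285, (103) p.293; Balaban1987RG1, (0.21) p.256] -/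
theorem QprOfRecord_surjective_hierFrameGL_ukSel {K k : ℕ} (hk : k ≤ (F.P K).m + (F.P K).K) {ε₀ : ℝ} (hε₀ : 0 < ε₀)
    (h3 : (143 * (((((F.P K).d + 4 : ℕ) : ℝ)) ^ 2 / 4) ^ 2) * ε₀ ≤ 1 / 3)
    (h2 : 2 * ε₀ ≤ 2 * deltaSU (Fin N) / ((((F.P K).d + 4) * (F.P K).L : ℕ) : ℝ) ^ 2)
    (hst : stokesConst (F.P K) * (2 * ε₀) < emlWeight (F.P K) / 16) (hstδ : stokesConst (F.P K) * (2 * ε₀) < deltaSU (Fin N))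
    (V : GaugeField (F.P K) k (SU N)) :
    Function.Surjective (QprOfRecord F N k (UkSel F N K k ε₀ V) (hierFrameGLDatumOfRecord F N k (UkSel F N K k ε₀ V))) :=
  QprOfRecord_surjective_hierFrameGL_of_mem_bgReg hk hε₀ h3 h2 hst hstδ (ukSel_mem_bgReg hk hε₀ V)

/-- ★★★ **THE GL PIN'S `hQ` ALONG THE GAUGE ORBIT OF A CLASS MEMBER** (`gaugeAct u U₀`, `U₀ ∈ bgReg F N K k ε₀`).
[cite: Balaban1985Variational, (2) p.278, (7)–(9) p.279, (44)–(45) p.285, (103) p.293] -/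
theorem QprOfRecord_surjective_hierFrameGL_gaugeAct {K k : ℕ} (hk : k ≤ (F.P K).m + (F.P K).K) {ε₀ : ℝ} (hε₀ : 0 < ε₀)
    (h3 : (143 * (((((F.P K).d + 4 : ℕ) : ℝ)) ^ 2 / 4) ^ 2) * ε₀ ≤ 1 / 3)
    (h2 : 2 * ε₀ ≤ 2 * deltaSU (Fin N) / ((((F.P K).d + 4) * (F.P K).L : ℕ) : ℝ) ^ 2)
    (hst : stokesConst (F.P K) * (2 * ε₀) < emlWeight (F.P K) / 16) (hstδ : stokesConst (F.P K) * (2 * ε₀) < deltaSU (Fin N))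
    {U₀ : GaugeField (F.P K) 0 (SU N)} (hU : U₀ ∈ bgReg F N K k ε₀) (u : GaugeTransf (F.P K) 0 (SU N)) :
    Function.Surjective (QprOfRecord F N k (gaugeAct u U₀) (hierFrameGLDatumOfRecord F N k (gaugeAct u U₀))) :=
  QprOfRecord_surjective_hierFrameGL_of_mem_bgReg hk hε₀ h3 h2 hst hstδ (gaugeAct_mem_bgReg' u U₀ hU)

/-- ★★★ **THE GL PIN'S `hQ` AT THE CENTRED ROOTED GAUGE OF THE SELECTOR** (`rootGaugeC k (UkSel F N K k ε₀ V)` — DEF-1's `recordBgFieldC` shape), every datum `V`.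
[cite: Balaban1985Variational, Thm 1 p.279, (7)–(9) p.279, (44)–(45) p.285, (103) p.293] -/
theorem QprOfRecord_surjective_hierFrameGL_rootGaugeC_ukSel {K k : ℕ} (hk : k ≤ (F.P K).m + (F.P K).K) {ε₀ : ℝ} (hε₀ : 0 < ε₀)
    (h3 : (143 * (((((F.P K).d + 4 : ℕ) : ℝ)) ^ 2 / 4) ^ 2) * ε₀ ≤ 1 / 3)
    (h2 : 2 * ε₀ ≤ 2 * deltaSU (Fin N) / ((((F.P K).d + 4) * (F.P K).L : ℕ) : ℝ) ^ 2)
    (hst : stokesConst (F.P K) * (2 * ε₀) < emlWeight (F.P K) / 16) (hstδ : stokesConst (F.P K) * (2 * ε₀) < deltaSU (Fin N))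
    (V : GaugeField (F.P K) k (SU N)) :
    Function.Surjective (QprOfRecord F N k (Summit.QuantumFields.YangMills.Theorems.RootedGaugeCentred.rootGaugeC k (UkSel F N K k ε₀ V))
      (hierFrameGLDatumOfRecord F N k (Summit.QuantumFields.YangMills.Theorems.RootedGaugeCentred.rootGaugeC k (UkSel F N K k ε₀ V)))) :=
  QprOfRecord_surjective_hierFrameGL_gaugeAct hk hε₀ h3 h2 hst hstδ (ukSel_mem_bgReg hk hε₀ V) _

/-- ★★★ **ONE ADMISSIBLE `ε₀ > 0` PER `(d, L, N)`** for which the GL pin's framed `hQ` holds at every `U₀ ∈ bgReg F N K k ε₀`, every `k ≤ m + K`.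
[cite: Balaban1985Variational, (2) p.278, (44)–(45) p.285, (103) p.293] -/
theorem exists_eps_QprOfRecord_surjective_hierFrameGL_of_mem_bgReg (F : T4Family) (N : ℕ) [NeZero N] (K : ℕ) :
    ∃ ε₀ : ℝ, 0 < ε₀ ∧ ∀ k : ℕ, k ≤ (F.P K).m + (F.P K).K → ∀ U₀ : GaugeField (F.P K) 0 (SU N), U₀ ∈ bgReg F N K k ε₀ →
      Function.Surjective (QprOfRecord F N k U₀ (hierFrameGLDatumOfRecord F N k U₀)) := by
  obtain ⟨ε₀, hε₀, h3, h2, hst, hstδ⟩ := exists_admissible_eps (F.P K) N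
  exact ⟨ε₀, hε₀, fun k hk U₀ hU => QprOfRecord_surjective_hierFrameGL_of_mem_bgReg hk hε₀ h3 h2 hst hstδ hU⟩

/-! ## §4 (v1.1)  On [15] (2)'s full space `𝔘_k({T}, ε₀)` of record (`InUkClassB11` — the guarded GL pin's own class letter `hcl`) -/

/-- ★★★ **THE UN-FRAMED ONTO ROW ON [15] (2)'s FULL SPACE AT THE RECORD** (`InUkClassB11 F N K k ε₀ U₀`, both clauses of (2); its plaquette half is `bgReg`,
`InUkClassB11.mem_bgReg`), `ε₀ > 0` below the four ceilings, `k ≤ m + K` ⟹ `Function.Surjective (qCplxOp k U₀)` — the binder `hqon` of the guarded GL pin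
✓`prop4UniformPrAtRecord_node00_of_prop5Clause_hierFrameGLRec_of_entryRows_guarded` from its own class letter `hcl`, at the price of the four ceilings on `ε₀`.
[cite: Balaban1985Variational, (2) p.278, (44)–(45) p.285; Balaban1985Averaging, Prop. 2 (52)–(54) p.26; Balaban1985BackgroundPropagators, (3.13)–(3.16) p.393] -/
theorem qCplxOp_surjective_of_inUkClassB11 {K k : ℕ} (hk : k ≤ (F.P K).m + (F.P K).K) {ε₀ : ℝ} (hε₀ : 0 < ε₀)
    (h3 : (143 * (((((F.P K).d + 4 : ℕ) : ℝ)) ^ 2 / 4) ^ 2) * ε₀ ≤ 1 / 3)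
    (h2 : 2 * ε₀ ≤ 2 * deltaSU (Fin N) / ((((F.P K).d + 4) * (F.P K).L : ℕ) : ℝ) ^ 2)
    (hst : stokesConst (F.P K) * (2 * ε₀) < emlWeight (F.P K) / 16) (hstδ : stokesConst (F.P K) * (2 * ε₀) < deltaSU (Fin N))
    {U₀ : GaugeField (F.P K) 0 (SU N)} (hU : InUkClassB11 F N K k ε₀ U₀) :
    Function.Surjective (qCplxOp k U₀) :=
  qCplxOp_surjective_of_mem_bgReg hk hε₀ h3 h2 hst hstδ hU.mem_bgReg

/-- ★ **THE RECORD'S GUARD ON (2)'s FULL SPACE**: `InUkClassB11 F N K k ε₀ U₀` (three ceilings) ⟹ `SmallBelow (avOfRecord F N K) k U₀`.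
[cite: Balaban1987RG1, (0.4) p.253; Balaban1985Variational, (2) p.278; Balaban1985Averaging, Prop. 2 (52)–(54) p.26] -/
theorem smallBelow_avOfRecord_of_inUkClassB11 {K k : ℕ} {ε₀ : ℝ} (hε₀ : 0 < ε₀)
    (h3 : (143 * (((((F.P K).d + 4 : ℕ) : ℝ)) ^ 2 / 4) ^ 2) * ε₀ ≤ 1 / 3)
    (h2 : 2 * ε₀ ≤ 2 * deltaSU (Fin N) / ((((F.P K).d + 4) * (F.P K).L : ℕ) : ℝ) ^ 2)
    (hstδ : stokesConst (F.P K) * (2 * ε₀) < deltaSU (Fin N))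
    {U₀ : GaugeField (F.P K) 0 (SU N)} (hU : InUkClassB11 F N K k ε₀ U₀) :
    SmallBelow (avOfRecord F N K) k U₀ :=
  smallBelow_avOfRecord_of_mem_bgReg hε₀ h3 h2 hstδ hU.mem_bgReg

/-- ★★★ **THE GL PIN'S FRAMED `hQ` ON [15] (2)'s FULL SPACE AT THE RECORD** (`InUkClassB11 F N K k ε₀ U₀`, `ε₀ > 0` below the four ceilings, `k ≤ m + K`):
`Function.Surjective (QprOfRecord F N k U₀ (hierFrameGLDatumOfRecord F N k U₀))`.
[cite: Balaban1985Variational, (2) p.278, (44)–(45) p.285, (103) p.293; Balaban1985BackgroundPropagators, (3.113)–(3.115) p.418] -/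
theorem QprOfRecord_surjective_hierFrameGL_of_inUkClassB11 {K k : ℕ} (hk : k ≤ (F.P K).m + (F.P K).K) {ε₀ : ℝ} (hε₀ : 0 < ε₀)
    (h3 : (143 * (((((F.P K).d + 4 : ℕ) : ℝ)) ^ 2 / 4) ^ 2) * ε₀ ≤ 1 / 3)
    (h2 : 2 * ε₀ ≤ 2 * deltaSU (Fin N) / ((((F.P K).d + 4) * (F.P K).L : ℕ) : ℝ) ^ 2)
    (hst : stokesConst (F.P K) * (2 * ε₀) < emlWeight (F.P K) / 16) (hstδ : stokesConst (F.P K) * (2 * ε₀) < deltaSU (Fin N))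
    {U₀ : GaugeField (F.P K) 0 (SU N)} (hU : InUkClassB11 F N K k ε₀ U₀) :
    Function.Surjective (QprOfRecord F N k U₀ (hierFrameGLDatumOfRecord F N k U₀)) :=
  QprOfRecord_surjective_hierFrameGL_of_mem_bgReg hk hε₀ h3 h2 hst hstδ hU.mem_bgReg

end Record

end Summit.QuantumFields.YangMills.Theorems.N07QCplxOpOntoGuarded

end
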